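import Mathlib
import HarnessLib
import Summits.CriticalPhenomena.SAWScalingLimit.Theorems.SAWSpinMonotoneQCIdentificationFacePotentialSeparation
import Summits.CriticalPhenomena.SAWScalingLimit.Theorems.SAWSpinMonotoneQCIdentificationStepLawArcs

/-!
# Face potentials on a simply connected hexagonal domain — the dual discrete Poincaré lemma
(helper, line `eight_fifths_primitive`)

Helper sub-goal (B) (wave 5) of the stub `stub_rayCondition` of line `eight_fifths_primitive`, crux
`QCIdentification` (stmt-CriticalPhenomena-16772); namespace of the checked skeleton, sub-namespace
`FacePot`; sibling of `…FacePotentialSeparation.lean` (the Jordan-type input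
`fp_hexagon_complete_of_joined`).

**What (registered `fp_exists_facePotential`).**  Let `Λ` be a finite set of faces of the
triangular lattice `𝕋` (= vertices of the honeycomb lattice `ℍ`, `HexVertex`) whose complement is
connected in `ℍ` (`hexDomainSimplyConnected Λ`; `Λ` itself need not be connected), and let
`d : HexVertex → HexVertex → M` (any additive commutative group `M`) be prescribed increments across
adjacent faces, ANTISYMMETRIC on `Λ` (`d w v = -d v w` for adjacent `v, w ∈ Λ`) and CLOSED around
every complete hexagon of `Λ` (`Σ_j d (face s j) (face s (j+1)) = 0` whenever all six faces
`HexKernel.face s j` around the site `s` lie in `Λ`).  Then there is a face potential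
`θ : HexVertex → M` with `θ w - θ v = d v w` for all adjacent `v, w ∈ Λ`.  (It is applied with
`d v w = arg (S_w / S_v)`, whose hexagon circulations vanish by `stub_noBranching`.)

**Proof.**  Induction on `|Λ|`, removing the topmost face `v` (maximising `2·x₁ + type`), which has a
neighbour `u ∉ Λ` above it, so that `Λ ∖ {v}` still has connected complement
(`PotentialExists.simplyConnected_erase`) and carries a potential `θ'` by induction.  A topmost UP
face `(x, 0)` has at most the one lower neighbour `(x - e₁, 1)` in `Λ`: set `θ v := θ' w + d w v`
(`extend_point`).  A topmost DOWN face `(y, 1)` has the two lower neighbours `w₁ = (y, 0)`,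
`w₂ = (y + e₀, 0)`, the faces `2` and `0` of the hexagon centred at `s = y + e₀` (face `1` being
`v`).  If `w₁`, `w₂` are NOT joined through faces of `Λ ∖ {v}`, re-gauge `θ'` by a constant on the
chain class of `w₂` so that `θ' w₂ - θ' w₁ = d w₁ v + d v w₂` (`regauge`); if they ARE joined, the
hexagon at `s` is complete (`fp_hexagon_complete_of_joined`), the increments of `θ'` along its lower
four edges `w₁ → 3 → 4 → 5 → w₂` are prescribed, and closedness around `s` gives the same identity
(`gap_of_joined`).  Then `θ v := θ' w₁ + d w₁ v` works (`extend_point`).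

Sources: folklore (the discrete Poincaré lemma / cycle space of a plane graph generated by its
faces, cf. Bondy–Murty, *Graph Theory* (2008), §10); the primal version
`PotentialExists.exists_potential` (`SAWDevelopingMapPotentialExistsPoincare.lean`) of this project.
-/

noncomputable section

open scoped BigOperators
open Literature.Probability.LatticeModels Literature.Probability.RandomPlanarGeometry
open Literature.Probability.RandomPlanarGeometry.SAW
open Literature.Barriers.CriticalPhenomena Literature.Barriers.CriticalPhenomena.HexKernel
open Summit.CriticalPhenomena.SAWScalingLimit.Theorems.PotentialExists (simplyConnected_erase)

namespace Summit.CriticalPhenomena.SAWScalingLimit.Cruxes.QCIdentification.EightFifthsPrimitive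

namespace FacePot

variable {M : Type*} [AddCommGroup M]

/-! ### Re-gauging a potential by a constant on a chain class -/

/-- **Re-gauging.**  A potential `θ'` for `d` on `Λ'` (correct increments across adjacent faces of
`Λ'`) can be modified, keeping all these increments, so as to acquire a prescribed difference `m`
between two faces `p`, `q` — provided the difference is already `m` whenever `p` and `q` are joined
by a chain of adjacent faces of `Λ'` (add a constant on the chain class of `q`). -/
theorem regauge {Λ' : Finset HexVertex} {d : HexVertex → HexVertex → M} {θ' : HexVertex → M}
    (hθ' : ∀ a ∈ Λ', ∀ b ∈ Λ', hexGraph.Adj a b → θ' b - θ' a = d a b) (p q : HexVertex) (m : M)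
    (hpq : Relation.ReflTransGen (fun a b : HexVertex => a ∈ Λ' ∧ b ∈ Λ' ∧ hexGraph.Adj a b) p q →
      θ' q - θ' p = m) :
    ∃ θ : HexVertex → M, (∀ a ∈ Λ', ∀ b ∈ Λ', hexGraph.Adj a b → θ b - θ a = d a b) ∧
      θ q - θ p = m := by
  classical
  set R := fun a b : HexVertex => a ∈ Λ' ∧ b ∈ Λ' ∧ hexGraph.Adj a b with hR
  have hRs : ∀ a b, R a b → R b a := fun a b ⟨ha, hb, hab⟩ => ⟨hb, ha, hab.symm⟩
  have hsymm : ∀ a b, Relation.ReflTransGen R a b → Relation.ReflTransGen R b a := by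
    intro a b h
    induction h with
    | refl => exact Relation.ReflTransGen.refl
    | tail _ hbc ih => exact Relation.ReflTransGen.head (hRs _ _ hbc) ih
  by_cases h : Relation.ReflTransGen R p q
  · exact ⟨θ', hθ', hpq h⟩
  · set c : M := m - (θ' q - θ' p) with hc
    refine ⟨fun f => θ' f + (if Relation.ReflTransGen R q f then c else 0), ?_, ?_⟩
    · intro a ha b hb hab
      have e : Relation.ReflTransGen R q a ↔ Relation.ReflTransGen R q b :=
        ⟨fun h' => h'.tail ⟨ha, hb, hab⟩, fun h' => h'.tail ⟨hb, ha, hab.symm⟩⟩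
      simp only [e]
      rw [← hθ' a ha b hb hab]
      abel
    · have hqp : ¬ Relation.ReflTransGen R q p := fun h' => h (hsymm _ _ h')
      have hqq : Relation.ReflTransGen R q q := Relation.ReflTransGen.refl
      simp only [if_pos hqq, if_neg hqp, hc]
      abel

/-! ### Adding back one face -/

/-- **One-face extension.**  Let `d` be antisymmetric on `Λ`, `v ∈ Λ`, and `θ'` a potential for `d`
on `Λ ∖ {v}`.  If for some base face `b₀` every neighbour `w ∈ Λ` of `v` satisfies
`θ' w - θ' b₀ = d b₀ v + d v w`, then `θ v := θ' b₀ + d b₀ v` (and `θ = θ'` elsewhere) is a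
potential for `d` on `Λ`. -/
theorem extend_point {Λ : Finset HexVertex} {d : HexVertex → HexVertex → M}
    (hanti : ∀ a ∈ Λ, ∀ b ∈ Λ, hexGraph.Adj a b → d b a = -d a b) {v : HexVertex} (hv : v ∈ Λ)
    {θ' : HexVertex → M}
    (hθ' : ∀ a ∈ Λ.erase v, ∀ b ∈ Λ.erase v, hexGraph.Adj a b → θ' b - θ' a = d a b)
    (b₀ : HexVertex) (hcompat : ∀ w ∈ Λ, hexGraph.Adj v w → θ' w - θ' b₀ = d b₀ v + d v w) :
    ∃ θ : HexVertex → M, ∀ a ∈ Λ, ∀ b ∈ Λ, hexGraph.Adj a b → θ b - θ a = d a b := by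
  classical
  refine ⟨fun f => if f = v then θ' b₀ + d b₀ v else θ' f, ?_⟩
  intro a ha b hb hab
  by_cases hav : a = v
  · subst hav
    have hba : b ≠ a := hab.ne.symm
    have hc := hcompat b hb hab
    dsimp only
    rw [if_pos rfl, if_neg hba,
      show θ' b - (θ' b₀ + d b₀ a) = (θ' b - θ' b₀) - d b₀ a by abel, hc]
    abel
  · by_cases hbv : b = v
    · subst hbv
      have hc := hcompat a ha hab.symm
      have ha' := hanti b hb a ha hab.symm
      dsimp only
      rw [if_pos rfl, if_neg hav,
        show θ' b₀ + d b₀ b - θ' a = d b₀ b - (θ' a - θ' b₀) by abel, hc, ha']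
      abel
    · dsimp only
      rw [if_neg hav, if_neg hbv]
      exact hθ' a (Finset.mem_erase.2 ⟨hav, ha⟩) b (Finset.mem_erase.2 ⟨hbv, hb⟩) hab

/-! ### The gap identity below a topmost down face -/

/-- **The gap identity.**  Let the complement of `Λ` be connected, `(y, 1) ∈ Λ`,
`(y + e₁, 0) ∉ Λ`, `d` antisymmetric on `Λ` and closed around the complete hexagons of `Λ`, and
`θ'` a potential for `d` on `Λ ∖ {(y, 1)}`.  If the lower neighbours `w₁ = (y, 0)` and
`w₂ = (y + e₀, 0)` are joined by a chain of adjacent faces of `Λ ∖ {(y, 1)}`, then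
`θ' w₂ - θ' w₁ = d w₁ (y, 1) + d (y, 1) w₂`: the hexagon at `y + e₀` is complete
(`fp_hexagon_complete_of_joined`), `θ'` has the prescribed increments along its four lower edges,
and the circulation around it vanishes. -/
theorem gap_of_joined {Λ : Finset HexVertex} (hΛ : hexDomainSimplyConnected Λ)
    {d : HexVertex → HexVertex → M}
    (hanti : ∀ a ∈ Λ, ∀ b ∈ Λ, hexGraph.Adj a b → d b a = -d a b)
    (hcl : ∀ s : Site 2, (∀ j : Fin 6, face s j ∈ Λ) →
      ∑ j : Fin 6, d (face s j) (face s (j + 1)) = 0)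
    {y : Site 2} (hv : (y, (1 : Fin 2)) ∈ Λ) (hu : (y + unitE1, (0 : Fin 2)) ∉ Λ)
    {θ' : HexVertex → M}
    (hθ' : ∀ a ∈ Λ.erase (y, 1), ∀ b ∈ Λ.erase (y, 1), hexGraph.Adj a b → θ' b - θ' a = d a b)
    (hreach : Relation.ReflTransGen
      (fun p q : HexVertex => p ∈ Λ.erase (y, 1) ∧ q ∈ Λ.erase (y, 1) ∧ hexGraph.Adj p q)
      (y, 0) (y + unitE0, 0)) :
    θ' (y + unitE0, 0) - θ' (y, 0) = d (y, 0) (y, 1) + d (y, 1) (y + unitE0, 0) := by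
  have hhex := fp_hexagon_complete_of_joined Λ hΛ y hv hu hreach
  set s : Site 2 := y + unitE0 with hs
  have hf0 : face s 0 = (y + unitE0, 0) := rfl
  have hf1 : face s 1 = (y, 1) := by simp [face, hs]
  have hf2 : face s 2 = (y, 0) := by simp [face, hs]
  have hne : ∀ j : Fin 6, j ≠ 1 → face s j ∈ Λ.erase (y, 1) := fun j hj =>
    Finset.mem_erase.2 ⟨fun h => hj ((face_inj s j 1).1 (h.trans hf1.symm)), hhex j⟩
  have a23 : hexGraph.Adj (face s 2) (face s 3) := by simpa using StepLaw.adj_face_succ s 2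
  have a34 : hexGraph.Adj (face s 3) (face s 4) := by simpa using StepLaw.adj_face_succ s 3
  have a45 : hexGraph.Adj (face s 4) (face s 5) := by simpa using StepLaw.adj_face_succ s 4
  have a50 : hexGraph.Adj (face s 5) (face s 0) := by simpa using StepLaw.adj_face_succ s 5
  have a01 : hexGraph.Adj (face s 0) (face s 1) := by simpa using StepLaw.adj_face_succ s 0
  have a12 : hexGraph.Adj (face s 1) (face s 2) := by simpa using StepLaw.adj_face_succ s 1
  have e23 := hθ' _ (hne 2 (by decide)) _ (hne 3 (by decide)) a23
  have e34 := hθ' _ (hne 3 (by decide)) _ (hne 4 (by decide)) a34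
  have e45 := hθ' _ (hne 4 (by decide)) _ (hne 5 (by decide)) a45
  have e50 := hθ' _ (hne 5 (by decide)) _ (hne 0 (by decide)) a50
  have n01 := hanti _ (hhex 0) _ (hhex 1) a01
  have n12 := hanti _ (hhex 1) _ (hhex 2) a12
  have hsum := hcl s hhex
  simp only [Fin.sum_univ_six, Fin.isValue, Fin.reduceAdd] at hsum
  rw [← hf0, ← hf1, ← hf2]
  rw [show θ' (face s 0) - θ' (face s 2) = (θ' (face s 3) - θ' (face s 2)) +
      (θ' (face s 4) - θ' (face s 3)) + (θ' (face s 5) - θ' (face s 4)) +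
      (θ' (face s 0) - θ' (face s 5)) by abel, e23, e34, e45, e50,
    show d (face s 2) (face s 3) + d (face s 3) (face s 4) + d (face s 4) (face s 5) +
      d (face s 5) (face s 0) = -(d (face s 0) (face s 1) + d (face s 1) (face s 2)) +
      (d (face s 0) (face s 1) + d (face s 1) (face s 2) + d (face s 2) (face s 3) +
      d (face s 3) (face s 4) + d (face s 4) (face s 5) + d (face s 5) (face s 0)) by abel,
    hsum, n01, n12]
  abel

/-! ### The dual discrete Poincaré lemma -/

/-- **Face potentials exist on simply connected hexagonal domains (dual discrete Poincaré
lemma).**  If the complement of the finite face set `Λ` is connected in `ℍ` and the increments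
`d` are antisymmetric across adjacent faces of `Λ` and have zero circulation around every complete
hexagon of `Λ`, then `d = δθ` on `Λ` for some face potential `θ : HexVertex → M`. -/
theorem fp_exists_facePotential : ∀ {M : Type*} [AddCommGroup M] (Λ : Finset HexVertex),
    hexDomainSimplyConnected Λ → ∀ (d : HexVertex → HexVertex → M),
      (∀ v ∈ Λ, ∀ w ∈ Λ, hexGraph.Adj v w → d w v = -d v w) →
      (∀ s : Site 2, (∀ j : Fin 6, HexKernel.face s j ∈ Λ) →
        ∑ j : Fin 6, d (HexKernel.face s j) (HexKernel.face s (j + 1)) = 0) →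
      ∃ θ : HexVertex → M, ∀ v ∈ Λ, ∀ w ∈ Λ, hexGraph.Adj v w → θ w - θ v = d v w := by
  intro M _ Λ hΛ d hanti hcl
  classical
  suffices key : ∀ (n : ℕ) (Λ : Finset HexVertex), Λ.card = n → hexDomainSimplyConnected Λ →
      (∀ v ∈ Λ, ∀ w ∈ Λ, hexGraph.Adj v w → d w v = -d v w) →
      (∀ s : Site 2, (∀ j : Fin 6, face s j ∈ Λ) →
        ∑ j : Fin 6, d (face s j) (face s (j + 1)) = 0) →
      ∃ θ : HexVertex → M, ∀ v ∈ Λ, ∀ w ∈ Λ, hexGraph.Adj v w → θ w - θ v = d v w from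
    key _ Λ rfl hΛ hanti hcl
  intro n
  induction n with
  | zero =>
    intro Λ hcard _ _ _
    rw [Finset.card_eq_zero] at hcard
    subst hcard
    exact ⟨fun _ => 0, fun v hv => by simp at hv⟩
  | succ m ih =>
    intro Λ hcard hΛ hanti hcl
    have hne : Λ.Nonempty := Finset.card_pos.1 (by omega)
    -- the topmost face of `Λ`
    obtain ⟨v, hv, hmax⟩ :=
      Finset.exists_max_image Λ (fun f : HexVertex => 2 * f.1 1 + ((f.2 : ℕ) : ℤ)) hne
    obtain ⟨x, k⟩ := v
    have hcard' : ∀ f ∈ Λ, (Λ.erase f).card = m := fun f hf => by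
      rw [Finset.card_erase_of_mem hf, hcard]; rfl
    have hanti' : ∀ f : HexVertex, ∀ v ∈ Λ.erase f, ∀ w ∈ Λ.erase f,
        hexGraph.Adj v w → d w v = -d v w :=
      fun f v hv w hw h => hanti v (Finset.mem_of_mem_erase hv) w (Finset.mem_of_mem_erase hw) h
    have hcl' : ∀ f : HexVertex, ∀ s : Site 2, (∀ j : Fin 6, face s j ∈ Λ.erase f) →
        ∑ j : Fin 6, d (face s j) (face s (j + 1)) = 0 :=
      fun f s hs => hcl s fun j => Finset.mem_of_mem_erase (hs j)
    have h0 := HexKernel.hexGraph_adj_iff_of_snd_eq_zero_holds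
    have h2 := HexKernel.not_hexGraph_adj_of_snd_eq_holds
    fin_cases k
    · -- up face `(x, 0)`: both upper neighbours `(x, 1)`, `(x - e₀, 1)` are outside `Λ`
      simp only [Fin.zero_eta] at hv hmax
      have hu1 : ((x, 1) : HexVertex) ∉ Λ := fun h => by
        have := hmax _ h
        simp at this
      have hu2 : ((x - unitE0, 1) : HexVertex) ∉ Λ := fun h => by
        have := hmax _ h
        simp at this
      have hadj1 : hexGraph.Adj ((x, 0) : HexVertex) (x, 1) :=
        (HexKernel.adj_up_iff h0 h2 x _).2 (Or.inl rfl)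
      obtain ⟨θ', hθ'⟩ := ih (Λ.erase (x, 0)) (hcard' _ hv) (simplyConnected_erase hΛ hu1 hadj1)
        (hanti' _) (hcl' _)
      refine extend_point hanti hv hθ' (x - unitE1, 1) fun w hw hadj => ?_
      rcases (HexKernel.adj_up_iff h0 h2 x w).1 hadj with rfl | rfl | rfl
      · exact absurd hw hu1
      · exact absurd hw hu2
      · rw [sub_self, hanti _ hv _ hw hadj, neg_add_cancel]
    · -- down face `(x, 1)`: the upper neighbour `(x + e₁, 0)` is outside `Λ`
      simp only [Fin.mk_one] at hv hmax
      have hu : ((x + unitE1, 0) : HexVertex) ∉ Λ := fun h => by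
        have := hmax _ h
        simp at this
        omega
      have hadj1 : hexGraph.Adj ((x, 1) : HexVertex) (x + unitE1, 0) :=
        (HexKernel.adj_down_iff h0 h2 x _).2 (Or.inr (Or.inr rfl))
      obtain ⟨θ', hθ'⟩ := ih (Λ.erase (x, 1)) (hcard' _ hv) (simplyConnected_erase hΛ hu hadj1)
        (hanti' _) (hcl' _)
      -- re-gauge so that the gap identity holds between the two lower neighbours
      obtain ⟨θ'', hθ'', hgap⟩ := regauge hθ' (x, 0) (x + unitE0, 0)
        (d (x, 0) (x, 1) + d (x, 1) (x + unitE0, 0)) (gap_of_joined hΛ hanti hcl hv hu hθ')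
      refine extend_point hanti hv hθ''
        (if ((x, 0) : HexVertex) ∈ Λ then ((x, 0) : HexVertex) else (x + unitE0, 0))
        fun w hw hadj => ?_
      rcases (HexKernel.adj_down_iff h0 h2 x w).1 hadj with rfl | rfl | rfl
      · rw [if_pos hw, sub_self, hanti _ hv _ hw hadj, neg_add_cancel]
      · by_cases hw₁ : ((x, 0) : HexVertex) ∈ Λ
        · rw [if_pos hw₁]
          exact hgap
        · rw [if_neg hw₁, sub_self, hanti _ hv _ hw hadj, neg_add_cancel]
      · exact absurd hw hu

end FacePot

end Summit.CriticalPhenomena.SAWScalingLimit.Cruxes.QCIdentification.EightFifthsPrimitive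

end
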